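import Summits.ABC.ABC.Theses.IsogenyGlueCongruence
import Literature.Barriers.BirchSwinnertonDyer.RankNotSumOfLocalInvariantsCNRanksA
import Literature.NumberTheory.EllipticCurves.IsogenyMordellWeilRankProofs
import Literature.NumberTheory.EllipticCurves.MazurTorsionGaloisStructureProofs
import Literature.NumberTheory.EllipticCurves.TwoDescentRankBounds
import Literature.NumberTheory.EllipticCurves.IsogenyTwoTorsionProofs
import Literature.NumberTheory.EllipticCurves.SelmerCorankProofs
import Literature.NumberTheory.EllipticCurves.KubertTwoTenProofs

/-!
# `PolyFreyMazurPairs` (crux `stmt-ABC-2047`, route `IsogenyGlueCongruence`): load-bearing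
# hypotheses and non-vacuity (negative-side support, cdisprove seat)

The crux `Summit.ABC.ABC.Theses.IsogenyGlueCongruence.PolyFreyMazurPairs`:
`∃ κ C, ∀ W W' elliptic/ℚ, ∀ ℓ prime, (Γ_ℚ-equivariant e : W[ℓ] ≃+ W'[ℓ]) → ¬ W.IsIsogenous W' →
ℓ ≤ C · max(N_W, N_W')^κ` (polynomial Frey–Mazur for pairs; known in substance from
Gaudron–Rémond 2023 Thm 1.5(1)+1.8 and `h_F ≪ N log N`).  The statements negated below are
written INLINE (no proposition is defined under `Summits/`); each is the crux with exactly one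
hypothesis deleted, everything else verbatim.  All sorry-free:

* `polyFreyMazurPairs_false_without_nonIsog` — delete `¬ W.IsIsogenous W'`: `W = W' = E₁`,
  `e = id`, and the primes are unbounded.
* `polyFreyMazurPairs_false_without_equivariance` — delete the `Γ_ℚ`-equivariance of `e`:
  `E₁ : y² = x³ − x` and `E₆ : y² = x³ − 36x` are PROVABLY non-`ℚ`-isogenous
  (`not_isIsogenous_E1_E6`: ranks `0 ≠ 1` by the tree's complete 2-descents and the isogeny
  invariance of the rank) while `E₁[ℓ] ≃+ E₆[ℓ]` abstractly for every prime `ℓ`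
  (`nonempty_addEquiv_geomTorsion_of_prime`: both are `𝔽_ℓ`-planes).
* `polyFreyMazurPairs_false_with_j_ne_for_nonIsog` — REPLACE `¬ W.IsIsogenous W'` by
  `W.j ≠ W'.j` (not even geometrically isomorphic): false, by the tree's explicit 2-isogeny
  `E₅ = X₁(2,10) : y² = x³ + x² − x → E₅' : y² = x³ − 2x² + 5x` (`twoIsogeny`, Silverman
  III.4.5; j-invariants 16384/5 ≠ 21296/25), which transports `E₅[ℓ] ≅ E₅'[ℓ]` equivariantly for every odd prime `ℓ`
  (`exists_equivariant_addEquiv_of_isogeny`).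
* `polyFreyMazurPairs_hypotheses_satisfiable` — NON-VACUITY: `(E₁, E₆, ℓ = 2)` satisfies every
  hypothesis of the crux (all `2`-torsion of `E_n` is rational, `smul_eq_self_of_mem_geomTorsion_two`,
  so any group isomorphism `E₁[2] ≃+ E₆[2]` is equivariant).

Moral for provers: the content of the torsion hypothesis is exactly its Galois-equivariance, and
non-isogeny over `ℚ` (not mere non-isomorphism) is what the bound can depend on; ℓ = 2 sharing
(quadratic twists) is ubiquitous and only constrains `C ≥ 2`.
-/

set_option linter.dupNamespace false

open scoped Classical

noncomputable section

namespace Summit.ABC.ABC.Theorems.PolyFreyMazurPairs.Negative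

open Literature.NumberTheory.EllipticCurves
open WeierstrassCurve

/-! ## Auxiliary certified facts about the witness pair (E₁, E₆) -/

/-- **A certified non-isogenous pair.** `E₁ : y² = x³ − x` (32a2) and `E₆ : y² = x³ − 36x`
are not `ℚ`-isogenous: the tree proves `rank E₁(ℚ) = 0`, `rank E₆(ℚ) = 1` by complete
2-descent (`CongruentDescent.E1/E6.mordellWeilRank_eq`) and isogeny invariance of the rank
(`IsIsogenous.mordellWeilRank_eq`). [folklore] -/
theorem not_isIsogenous_E1_E6 :
    ¬ (congruentNumberCurve 1).IsIsogenous (congruentNumberCurve 6) := by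
  intro h
  have h1 := Literature.Barriers.BirchSwinnertonDyer.CongruentDescent.E1.mordellWeilRank_eq
  have h6 := Literature.Barriers.BirchSwinnertonDyer.CongruentDescent.E6.mordellWeilRank_eq
  have := h.mordellWeilRank_eq
  simp only [Literature.Barriers.BirchSwinnertonDyer.CongruentDescent.E1.E,
    Literature.Barriers.BirchSwinnertonDyer.CongruentDescent.E6.E] at h1 h6
  omega

/-- **Abstractly, all ℓ-torsion groups look alike.** For elliptic `W, W'` over `ℚ` and a prime
`ℓ`, `W[ℓ] ≃+ W'[ℓ]` as bare groups (both are `𝔽_ℓ`-planes: `#E[ℓ] = ℓ²`, tree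
`natCard_geomTorsion`, + `LinearEquiv.ofFinrankEq`). So the Galois-equivariance of `e` is the whole
content of the torsion hypothesis. [folklore] -/
theorem nonempty_addEquiv_geomTorsion_of_prime (W W' : WeierstrassCurve ℚ) [W.IsElliptic]
    [W'.IsElliptic] {ℓ : ℕ} (hℓ : ℓ.Prime) : Nonempty (W.geomTorsion ℓ ≃+ W'.geomTorsion ℓ) := by
  haveI := Fact.mk hℓ
  haveI : NeZero (ℓ : ℚ) := ⟨by exact_mod_cast hℓ.ne_zero⟩
  letI m1 : Module (ZMod ℓ) (W.geomTorsion ℓ) := AddSubgroup.torsionBy.zmodModule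
  letI m2 : Module (ZMod ℓ) (W'.geomTorsion ℓ) := AddSubgroup.torsionBy.zmodModule
  have hc : Nat.card (W.geomTorsion ℓ) = ℓ ^ 2 := natCard_geomTorsion W ℓ
  have hc' : Nat.card (W'.geomTorsion ℓ) = ℓ ^ 2 := natCard_geomTorsion W' ℓ
  haveI : Finite (W.geomTorsion ℓ) :=
    Nat.finite_of_card_ne_zero (by rw [hc]; exact pow_ne_zero 2 hℓ.ne_zero)
  haveI : Finite (W'.geomTorsion ℓ) :=
    Nat.finite_of_card_ne_zero (by rw [hc']; exact pow_ne_zero 2 hℓ.ne_zero)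
  haveI : Module.Finite (ZMod ℓ) (W.geomTorsion ℓ) := Module.Finite.of_finite
  haveI : Module.Finite (ZMod ℓ) (W'.geomTorsion ℓ) := Module.Finite.of_finite
  have hr : Module.finrank (ZMod ℓ) (W.geomTorsion ℓ) = 2 := by
    have h := Module.natCard_eq_pow_finrank (K := ZMod ℓ) (V := W.geomTorsion ℓ)
    rw [hc, Nat.card_zmod] at h
    exact (Nat.pow_right_injective hℓ.two_le h).symm
  have hr' : Module.finrank (ZMod ℓ) (W'.geomTorsion ℓ) = 2 := by
    have h := Module.natCard_eq_pow_finrank (K := ZMod ℓ) (V := W'.geomTorsion ℓ)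
    rw [hc', Nat.card_zmod] at h
    exact (Nat.pow_right_injective hℓ.two_le h).symm
  exact ⟨(LinearEquiv.ofFinrankEq (R := ZMod ℓ) (W.geomTorsion ℓ) (W'.geomTorsion ℓ)
    (hr.trans hr'.symm)).toAddEquiv⟩

/-! ## (a) Load-bearing hypotheses -/

/-- **Any proof must use `¬ W.IsIsogenous W'`.** The crux with the non-isogeny hypothesis
DELETED (inline, verbatim otherwise) is false: take `W = W' = E₁ : y² = x³ − x` and `e = id`
(trivially `Γ_ℚ`-equivariant); the conclusion would bound EVERY prime `ℓ` by the constant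
`C · N^κ`. [folklore] -/
theorem polyFreyMazurPairs_false_without_nonIsog :
    ¬ ∃ κ C : ℝ, ∀ (W W' : WeierstrassCurve ℚ) [W.IsElliptic] [W'.IsElliptic] (ℓ : ℕ), ℓ.Prime →
      (∃ e : W.geomTorsion ℓ ≃+ W'.geomTorsion ℓ,
        ∀ (σ : Field.absoluteGaloisGroup ℚ) (P : W.geomTorsion ℓ), e (σ • P) = σ • e P) →
      (ℓ : ℝ) ≤ C * (max (W.conductorNorm ℤ) (W'.conductorNorm ℤ) : ℝ) ^ κ := by
  rintro ⟨κ, C, h⟩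
  set B : ℝ := C * (max ((congruentNumberCurve 1).conductorNorm ℤ)
    ((congruentNumberCurve 1).conductorNorm ℤ) : ℝ) ^ κ with hB
  obtain ⟨ℓ, hℓ, hp⟩ := Nat.exists_infinite_primes (⌈B⌉₊ + 1)
  have key := h (congruentNumberCurve 1) (congruentNumberCurve 1) ℓ hp
    ⟨AddEquiv.refl _, fun σ P => rfl⟩
  have hc := Nat.le_ceil B
  have hℓ' : ((⌈B⌉₊ + 1 : ℕ) : ℝ) ≤ ℓ := by exact_mod_cast hℓ
  push_cast at hℓ'
  rw [← hB] at key
  linarith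

/-- **Any proof must use the Galois-equivariance of `e`.** The crux with the equivariance of
`e` DELETED (a bare group isomorphism of the `ℓ`-torsion; inline, verbatim otherwise) is false:
`E₁, E₆` are non-isogenous (`not_isIsogenous_E1_E6`) and `E₁[ℓ] ≃+ E₆[ℓ]` abstractly for EVERY
prime `ℓ` (`nonempty_addEquiv_geomTorsion_of_prime`), while `C · max(N₁, N₆)^κ` is a constant.
[folklore] -/
theorem polyFreyMazurPairs_false_without_equivariance :
    ¬ ∃ κ C : ℝ, ∀ (W W' : WeierstrassCurve ℚ) [W.IsElliptic] [W'.IsElliptic] (ℓ : ℕ), ℓ.Prime →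
      Nonempty (W.geomTorsion ℓ ≃+ W'.geomTorsion ℓ) → ¬ W.IsIsogenous W' →
      (ℓ : ℝ) ≤ C * (max (W.conductorNorm ℤ) (W'.conductorNorm ℤ) : ℝ) ^ κ := by
  rintro ⟨κ, C, h⟩
  set B : ℝ := C * (max ((congruentNumberCurve 1).conductorNorm ℤ)
    ((congruentNumberCurve 6).conductorNorm ℤ) : ℝ) ^ κ with hB
  obtain ⟨ℓ, hℓ, hp⟩ := Nat.exists_infinite_primes (⌈B⌉₊ + 1)
  have key := h (congruentNumberCurve 1) (congruentNumberCurve 6) ℓ hp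
    (nonempty_addEquiv_geomTorsion_of_prime _ _ hp) not_isIsogenous_E1_E6
  have hc := Nat.le_ceil B
  have hℓ' : ((⌈B⌉₊ + 1 : ℕ) : ℝ) ≤ ℓ := by exact_mod_cast hℓ
  push_cast at hℓ'
  rw [← hB] at key
  linarith

/-! ## (b) Non-vacuity: a certified torsion-sharing, non-isogenous pair at ℓ = 2 -/

/-- `E_n` over `ℚ̄` has split `2`-torsion with abscissae `-n, 0, n`. [folklore] -/
theorem splitTwoTorsion_cn_geom (n : ℕ) :
    ((congruentNumberCurve n).baseChange (AlgebraicClosure ℚ)).toAffine.SplitTwoTorsion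
      (-(n : AlgebraicClosure ℚ)) 0 n where
  b₂_eq := by
    show ((congruentNumberCurve n).map (algebraMap ℚ (AlgebraicClosure ℚ))).b₂ = _
    rw [map_b₂]; simp [WeierstrassCurve.b₂, congruentNumberCurve]
  b₄_eq := by
    show ((congruentNumberCurve n).map (algebraMap ℚ (AlgebraicClosure ℚ))).b₄ = _
    rw [map_b₄]; simp [WeierstrassCurve.b₄, congruentNumberCurve]; ring
  b₆_eq := by
    show ((congruentNumberCurve n).map (algebraMap ℚ (AlgebraicClosure ℚ))).b₆ = _
    rw [map_b₆]; simp [WeierstrassCurve.b₆, congruentNumberCurve]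

/-- Every geometric `2`-torsion point of `E_n` (`n ≠ 0`) is fixed by `Gal(ℚ̄/ℚ)`: `E_n[2] =
{O, (−n,0), (0,0), (n,0)} ⊂ E_n(ℚ)`. [folklore] -/
theorem smul_eq_self_of_mem_geomTorsion_two {n : ℕ} (hn : n ≠ 0)
    (σ : Field.absoluteGaloisGroup ℚ) {P : (congruentNumberCurve n).geomPoints}
    (hP : P ∈ (congruentNumberCurve n).geomTorsion (2 : ℕ)) : σ • P = P := by
  haveI := isElliptic_congruentNumberCurve hn
  set τ : AlgebraicClosure ℚ ≃ₐ[ℚ] AlgebraicClosure ℚ := σ with hτ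
  have h2 : (2 : ℕ) • P = 0 := AddSubgroup.torsionBy.nsmul_iff.mp hP
  have hsplit := splitTwoTorsion_cn_geom n
  have hy : ∀ e : AlgebraicClosure ℚ,
      ((congruentNumberCurve n).baseChange (AlgebraicClosure ℚ)).toAffine.twoTorsionY e = 0 := by
    intro e
    simp [Affine.twoTorsionY]
  have key := Affine.Point.eq_zero_or_eq_twoTorsion_of_two_nsmul_eq_zero hsplit
    (P := (P : ((congruentNumberCurve n).baseChange (AlgebraicClosure ℚ)).toAffine.Point)) h2
  have hfix : ∀ (Q : (congruentNumberCurve n).geomPoints) (x : AlgebraicClosure ℚ)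
      (h : ((congruentNumberCurve n).baseChange (AlgebraicClosure ℚ)).toAffine.Nonsingular x
        (((congruentNumberCurve n).baseChange (AlgebraicClosure ℚ)).toAffine.twoTorsionY x)),
      Q = Affine.Point.some x _ h → τ x = x → σ • Q = Q := by
    intro Q x h hQ hx
    subst hQ
    change Affine.Point.map (τ : AlgebraicClosure ℚ →ₐ[ℚ] AlgebraicClosure ℚ)
      (Affine.Point.some x _ h) = _
    rw [Affine.Point.map_some]
    simp only [Affine.Point.some.injEq, AlgEquiv.coe_toAlgHom]
    refine ⟨hx, ?_⟩
    rw [hy, map_zero]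
  rcases key with h0 | hQ | hQ | hQ
  · have h0' : P = (0 : (congruentNumberCurve n).geomPoints) := h0
    rw [h0']
    have : σ • (0 : (congruentNumberCurve n).geomPoints) = 0 := smul_zero σ
    exact this
  · exact hfix P _ _ hQ (by rw [map_neg, map_natCast])
  · exact hfix P _ _ hQ (by rw [map_zero])
  · exact hfix P _ _ hQ (by rw [map_natCast])

/-- **The crux's hypotheses are SATISFIABLE (non-vacuity), at ℓ = 2:** `E₁ : y² = x³ − x` and
`E₆ : y² = x³ − 36x` are non-`ℚ`-isogenous elliptic curves whose `2`-torsion Galois modules are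
isomorphic (both are the trivial module `(ℤ/2)²`, all `2`-torsion being rational, so ANY group
isomorphism is equivariant).  This is the ℓ = 2 shadow of the quadratic-twist phenomenon (`E₆` is
the twist of `E₁` by `6`; `E[2] ⊗ χ = E[2]`): ℓ = 2 torsion-sharing is ubiquitous and harmless
(it only forces `C · max(N,N')^κ ≥ 2`).  In print the largest torsion-sharing prime between
non-isogenous curves over `ℚ` is 17 (Cremona–Freitas 2022), far beyond certification here.
[folklore] -/
theorem polyFreyMazurPairs_hypotheses_satisfiable :
    ∃ (W W' : WeierstrassCurve ℚ) (_ : W.IsElliptic) (_ : W'.IsElliptic) (ℓ : ℕ), ℓ.Prime ∧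
      (∃ e : W.geomTorsion ℓ ≃+ W'.geomTorsion ℓ,
        ∀ (σ : Field.absoluteGaloisGroup ℚ) (P : W.geomTorsion ℓ), e (σ • P) = σ • e P) ∧
      ¬ W.IsIsogenous W' := by
  refine ⟨congruentNumberCurve 1, congruentNumberCurve 6, inferInstance, inferInstance, 2,
    Nat.prime_two, ?_, not_isIsogenous_E1_E6⟩
  obtain ⟨e⟩ := nonempty_addEquiv_geomTorsion_of_prime (congruentNumberCurve 1)
    (congruentNumberCurve 6) Nat.prime_two
  refine ⟨e, fun σ P => ?_⟩
  have h1 : σ • P = P :=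
    Subtype.ext (smul_eq_self_of_mem_geomTorsion_two one_ne_zero σ P.2)
  have h2 : σ • e P = e P :=
    Subtype.ext (smul_eq_self_of_mem_geomTorsion_two (by norm_num) σ (e P).2)
  rw [h1, h2]

/-! ## (c) Non-isogeny cannot be weakened to `j ≠ j'` (isogenous curves share torsion) -/

/-- **Isogenies transport torsion modules.** An isogeny `φ : W → W'` over `ℚ` whose kernel meets
`W[ℓ]` trivially (`ℓ` prime) restricts to a `Γ_ℚ`-equivariant isomorphism `W[ℓ] ≃+ W'[ℓ]`
(injective + `#W[ℓ] = #W'[ℓ] = ℓ²`). Silverman AEC III.4, VII.7. [folklore] -/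
theorem exists_equivariant_addEquiv_of_isogeny {W W' : WeierstrassCurve ℚ} [W.IsElliptic]
    [W'.IsElliptic] (φ : Isogeny W W') {ℓ : ℕ} (hℓ : ℓ.Prime)
    (hker : ∀ P : W.geomPoints, φ P = 0 → P ∈ W.geomTorsion ℓ → P = 0) :
    ∃ e : W.geomTorsion ℓ ≃+ W'.geomTorsion ℓ,
      ∀ (σ : Field.absoluteGaloisGroup ℚ) (P : W.geomTorsion ℓ), e (σ • P) = σ • e P := by
  haveI := Fact.mk hℓ
  haveI : NeZero (ℓ : ℚ) := ⟨by exact_mod_cast hℓ.ne_zero⟩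
  set f : W.geomTorsion ℓ →+ W'.geomTorsion ℓ := torsionByMap φ.toAddMonoidHom ℓ with hf
  have hfapply : ∀ P : W.geomTorsion ℓ, ((f P : W'.geomTorsion ℓ) : W'.geomPoints) = φ P :=
    fun P => rfl
  have hinj : Function.Injective f := by
    intro x y hxy
    apply Subtype.ext
    have hφ : φ (x : W.geomPoints) = φ (y : W.geomPoints) := by
      have := congrArg (fun z : W'.geomTorsion ℓ => (z : W'.geomPoints)) hxy
      simpa only [hfapply] using this
    have h1 : φ ((x : W.geomPoints) - y) = 0 := by rw [map_sub, hφ, sub_self]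
    exact sub_eq_zero.mp (hker _ h1 (sub_mem x.2 y.2))
  have hc : Nat.card (W.geomTorsion ℓ) = ℓ ^ 2 := natCard_geomTorsion W ℓ
  have hc' : Nat.card (W'.geomTorsion ℓ) = ℓ ^ 2 := natCard_geomTorsion W' ℓ
  haveI : Finite (W'.geomTorsion ℓ) :=
    Nat.finite_of_card_ne_zero (by rw [hc']; exact pow_ne_zero 2 hℓ.ne_zero)
  have hbij : Function.Bijective f := hinj.bijective_of_nat_card_le (by rw [hc, hc'])
  refine ⟨AddEquiv.ofBijective f hbij, fun σ P => ?_⟩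
  apply Subtype.ext
  show ((f (σ • P) : W'.geomTorsion ℓ) : W'.geomPoints) = σ • ((f P : W'.geomTorsion ℓ) : W'.geomPoints)
  rw [hfapply, hfapply]
  exact φ.equivariant σ P

/-- For `V : y² = x³ + ax² + bx` (two-torsion normal form, elliptic) and an ODD prime `ℓ`, the
kernel `{O, T}` of the explicit 2-isogeny `V.twoIsogeny` meets `V[ℓ]` trivially (`T` has order 2).
[folklore] -/
theorem ker_twoIsogeny_inter_torsion (V : WeierstrassCurve ℚ) [V.IsTwoTorsionNF] [V.IsElliptic]
    {ℓ : ℕ} (hℓ : ℓ.Prime) (hℓ2 : ℓ ≠ 2) (P : V.geomPoints) (hP : V.twoIsogeny P = 0)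
    (hPℓ : P ∈ V.geomTorsion ℓ) : P = 0 := by
  have hmem : P ∈ ((V.twoIsogeny).toAddMonoidHom.ker : Set V.geomPoints) := hP
  rw [ker_twoIsogeny] at hmem
  rcases hmem with h0 | hT
  · exact h0
  · exfalso
    rw [Set.mem_singleton_iff] at hT
    subst hT
    have h2 : (2 : ℕ) • V.geomTwoTorsionPoint = 0 := by
      rw [two_nsmul]
      exact twoTorsionPoint_add_twoTorsionPoint (V.baseChange (AlgebraicClosure ℚ))
    have hℓT : ℓ • V.geomTwoTorsionPoint = 0 := AddSubgroup.torsionBy.nsmul_iff.mp hPℓ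
    obtain ⟨m, hm⟩ := hℓ.odd_of_ne_two hℓ2
    rw [hm, add_nsmul, mul_nsmul, h2, nsmul_zero, zero_add, one_nsmul] at hℓT
    exact geomTwoTorsionPoint_ne_zero V hℓT

/-- **Isogenous curves in two-torsion normal form share all odd torsion modules**: for `V` as
above and every odd prime `ℓ`, `V[ℓ] ≅ V'[ℓ]` `Γ_ℚ`-equivariantly, `V' = V.twoIsogenyCodomain`
(`y² = x³ − 2ax² + (a² − 4b)x`, Silverman AEC III.4.5). [folklore] -/
theorem exists_equivariant_addEquiv_twoIsogeny (V : WeierstrassCurve ℚ) [V.IsTwoTorsionNF]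
    [V.IsElliptic] {ℓ : ℕ} (hℓ : ℓ.Prime) (hℓ2 : ℓ ≠ 2) :
    ∃ e : V.geomTorsion ℓ ≃+ V.twoIsogenyCodomain.geomTorsion ℓ,
      ∀ (σ : Field.absoluteGaloisGroup ℚ) (P : V.geomTorsion ℓ), e (σ • P) = σ • e P :=
  exists_equivariant_addEquiv_of_isogeny V.twoIsogeny hℓ
    (fun P hP hPℓ => ker_twoIsogeny_inter_torsion V hℓ hℓ2 P hP hPℓ)

/-- `E₅ : y² = x³ + x² − x = ⟨0, 1, 0, -1, 0⟩` is the tree's model of `X₁(2,10)` (conductor 20,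
isogeny class Cremona 20a; `Literature.NumberTheory.EllipticCurves.isElliptic_X1TwoTen`,
`X1TwoTen_Δ = 80`, file `KubertTwoTenProofs`), written literally so that nothing but theorems is
declared here.  `j(E₅) = 16384/5 ≠ 21296/25 = j(E₅')` for `E₅' = E₅.twoIsogenyCodomain :
y² = x³ − 2x² + 5x`: the two 2-isogenous curves are not isomorphic, even over `ℚ̄`. [folklore] -/
theorem j_E5_ne [(⟨0, 1, 0, -1, 0⟩ : WeierstrassCurve ℚ).IsElliptic] :
    (⟨0, 1, 0, -1, 0⟩ : WeierstrassCurve ℚ).j ≠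
      (⟨0, 1, 0, -1, 0⟩ : WeierstrassCurve ℚ).twoIsogenyCodomain.j := by
  have hΔ : (⟨0, 1, 0, -1, 0⟩ : WeierstrassCurve ℚ).Δ = 80 := by
    rw [Δ_of_isTwoTorsionNF]; norm_num
  have hΔ' : (⟨0, 1, 0, -1, 0⟩ : WeierstrassCurve ℚ).twoIsogenyCodomain.Δ = -6400 := by
    rw [twoIsogenyCodomain_Δ]; norm_num
  have hj : (⟨0, 1, 0, -1, 0⟩ : WeierstrassCurve ℚ).j = 16384 / 5 := by
    rw [WeierstrassCurve.j, Units.val_inv_eq_inv_val, coe_Δ', hΔ]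
    norm_num [WeierstrassCurve.c₄, WeierstrassCurve.b₂, WeierstrassCurve.b₄]
  have hj' : (⟨0, 1, 0, -1, 0⟩ : WeierstrassCurve ℚ).twoIsogenyCodomain.j = 21296 / 25 := by
    rw [WeierstrassCurve.j, Units.val_inv_eq_inv_val, coe_Δ', hΔ']
    norm_num [WeierstrassCurve.c₄, WeierstrassCurve.b₂, WeierstrassCurve.b₄, twoIsogenyCodomain]
  rw [hj, hj']; norm_num

/-- **`¬ IsIsogenous` cannot be weakened to non-isomorphism (even geometric: `j ≠ j'`).** The
crux with `¬ W.IsIsogenous W'` REPLACED by `W.j ≠ W'.j` (inline, verbatim otherwise) is false: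
`E₅ : y² = x³ + x² − x` and its 2-isogenous `E₅' : y² = x³ − 2x² + 5x` (tree `twoIsogeny`,
Silverman AEC III.4.5) have `j = 16384/5 ≠ 21296/25`, yet `E₅[ℓ] ≅ E₅'[ℓ]` `Γ_ℚ`-equivariantly
for EVERY odd prime `ℓ`.  The bound is a statement about ISOGENY CLASSES: no invariant separating
isogenous curves (`j`, `Δ_min`, torsion order, …) can replace non-isogeny. [folklore] -/
theorem polyFreyMazurPairs_false_with_j_ne_for_nonIsog :
    ¬ ∃ κ C : ℝ, ∀ (W W' : WeierstrassCurve ℚ) [W.IsElliptic] [W'.IsElliptic] (ℓ : ℕ),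
      ℓ.Prime → (∃ e : W.geomTorsion ℓ ≃+ W'.geomTorsion ℓ,
        ∀ (σ : Field.absoluteGaloisGroup ℚ) (P : W.geomTorsion ℓ), e (σ • P) = σ • e P) →
      W.j ≠ W'.j → (ℓ : ℝ) ≤ C * (max (W.conductorNorm ℤ) (W'.conductorNorm ℤ) : ℝ) ^ κ := by
  rintro ⟨κ, C, h⟩
  -- generic contradiction for any NF curve V with j(V) ≠ j(V')
  have main : ∀ (V : WeierstrassCurve ℚ) [V.IsTwoTorsionNF] [V.IsElliptic],
      V.j ≠ V.twoIsogenyCodomain.j → False := by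
    intro V _ _ hj
    set B : ℝ := C * (max (V.conductorNorm ℤ) (V.twoIsogenyCodomain.conductorNorm ℤ) : ℝ) ^ κ
      with hB
    obtain ⟨ℓ, hℓ, hp⟩ := Nat.exists_infinite_primes (⌈B⌉₊ + 3)
    have hℓ2 : ℓ ≠ 2 := by omega
    have key := h V V.twoIsogenyCodomain ℓ hp (exists_equivariant_addEquiv_twoIsogeny V hp hℓ2) hj
    have hc := Nat.le_ceil B
    have hℓ' : ((⌈B⌉₊ + 3 : ℕ) : ℝ) ≤ ℓ := by exact_mod_cast hℓ
    push_cast at hℓ'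
    rw [← hB] at key
    linarith
  haveI := isElliptic_X1TwoTen
  exact main ⟨0, 1, 0, -1, 0⟩ j_E5_ne

end Summit.ABC.ABC.Theorems.PolyFreyMazurPairs.Negative

end
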